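import Summits.BirchSwinnertonDyer.BirchSwinnertonDyer.Theorems.BiquadraticEisensteinDescentSiftedVarianceCensusDefs
import Literature.NumberTheory.Sieve.RoughNumbersInProgressions
import HarnessLib

set_option linter.dupNamespace false -- `Summit.BirchSwinnertonDyer.BirchSwinnertonDyer.Theorems.…` (summit = sub)
set_option autoImplicit false

/-!
# Crux `HeegnerTwistCouplingInSupply` (stmt-BirchSwinnertonDyer-21381), crux idea `sifted-variance-twist-census`:
# THE GLUE `CensusOfMoments` — «sifted first + mixed second moment ⇒ cell-free census» — PROVED UNCONDITIONALLY

Cell `pub/bsd-wall`, width-prover seat `bsd-wall-cm-bed-w1` g19 (explicit-unit; helper for stmt-BirchSwinnertonDyer-21381,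
closes nothing). Companion of the reviewed Defs file `…BiquadraticEisensteinDescentSiftedVarianceCensusDefs.lean` (p706322),
which types the objects of the crux idea card `Cruxes/HeegnerTwistCouplingInSupply/Ideas/sifted-variance-twist-census.md`
(cruxidea seat 2 g25, 2026-08-29) verbatim from its sketch `SketchIdeasSeat2G25b.lean`. The card marks its glue
`CensusOfMoments : (∃ A > 0, SiftedMoments A) → CellFreeCensus` as «S-sized bookkeeping (Chebyshev: an exceptional modulus
contributes `(0 − 1)² = 1` to the variance; primes `> Q^{1/8}` lie in the sifted set; `#sifted ≍ Q / log Q`)»; this file PROVES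
it with no hypothesis:

* §1 the iterated integer square roots `r(Q) = ⌊⌊⌊√Q⌋^{1/2}⌋^{1/2}⌋` (`q ≤ r(Q) ↔ q⁸ ≤ Q`) and `t(Q) = ⌊√r(Q)⌋`
  (`q ≤ t(Q) ↔ q¹⁶ ≤ Q`, `Q < (t(Q)+1)¹⁶`);
* §2 `mem_sifted_iff`, `prime_mem_sifted` (a prime `p ≤ Q`, `p ≡ 7 (16)`, `p > r(Q)` is a sifted modulus),
  `coprime_primesProdBelow_of_mem_sifted` (a sifted modulus is prime to `P(t(Q)+1)`);
* §3 ★ `card_sifted_le` — THE SIEVE COUNT `#sifted(Q) ≤ C · Q / log Q` for all `Q ≥ 2` (`C = 16400 K`), from the tree's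
  PROVED Brun–Titchmarsh-type bound for `z`-rough integers in progressions
  `Literature.NumberTheory.Sieve.card_roughAP_le` (beta-sieve, `#{n ≤ y : n ≡ s (q), (n, P(z)) = 1} ≤ K (y/(φ(q) log z) + z¹⁰)`)
  with `q = 1`, `z = t(Q) + 1 ≈ Q^{1/16}`, and the elementary `log Q < 16 log z ≤ 16 t(Q)`, `z¹⁰ ≤ 2¹⁴ Q / log Q`;
* §4 the Chebyshev step `sum_sub_one_sq_le` (`|Σ(x−1)| ≤ εn ∧ Σx² ≤ (1+ε)n ⇒ Σ(x−1)² ≤ 3εn`) and `card_le_sum_sub_one_sq`;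
* §5 the exceptional primes of `CellFreeCensus` (written out as the counted finset): their window moment
  vanishes, those `> r(Q)` are sifted, those `≤ r(Q)` number `≤ r(Q)`; ★ `card_exceptional_le_of_moments` — the explicit
  census `#exceptional(Q) ≤ 3ε · #sifted(Q) + r(Q)` from the two moment inequalities at height `Q` (no largeness);
* §6 `sqrt_sqrt_sqrt_le_eventually` (`r(Q) ≤ δ Q / log Q` for large `Q`) and ★★ `censusOfMoments : CensusOfMoments`
  (choose `ε₁ = ε/(6C)` in `SiftedMoments`), `cellFreeCensus_of_siftedMoments`.

HONEST LIMITS: this certifies ONLY the card's COMPOSITION step (K1 + K2 ⇒ census). The analytic input `SiftedMoments`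
(an X. Li-type MIXED second moment of `L(½, f_{B₁} ⊗ χ_{md})` over a sieve-weighted two-parameter family with a polylog
inner window, arXiv:2208.07343 Thm 1.1 extended as the card says) is RESEARCH and is NOT proved here or anywhere in the tree;
the census is rung-level (corner `j = 8000`, `p ≡ 7 (16)`) and is NOT a line for the crux; the `∀ p` crux
`HeegnerTwistCouplingInSupply` (C⁺) and BSD are NOT touched; nothing is closed. THEOREMS ONLY; standard axioms. Supports stmt-BirchSwinnertonDyer-21381.
-/

noncomputable section

open scoped Classical

open Literature.NumberTheory.EllipticCurves Literature.NumberTheory.Sieve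

namespace Summit.BirchSwinnertonDyer.BirchSwinnertonDyer.Theorems.SiftedVarianceCensus

/-! ## §1 The iterated integer square roots `r(Q) = ⌊⌊⌊√Q⌋^{1/2}⌋^{1/2}⌋ ≈ Q^{1/8}` and `t(Q) = ⌊√r(Q)⌋ ≈ Q^{1/16}` -/

/-- `q ≤ r(Q) ↔ q⁸ ≤ Q` for the sifting bound `r(Q) = Nat.sqrt (Nat.sqrt (Nat.sqrt Q))` of `sifted`. -/
theorem le_sqrt_sqrt_sqrt_iff (q Q : ℕ) : q ≤ Nat.sqrt (Nat.sqrt (Nat.sqrt Q)) ↔ q ^ 8 ≤ Q := by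
  rw [Nat.le_sqrt', Nat.le_sqrt', Nat.le_sqrt', ← pow_mul, ← pow_mul]

/-- `r(Q)⁸ ≤ Q`. -/
theorem sqrt_sqrt_sqrt_pow_eight_le (Q : ℕ) : Nat.sqrt (Nat.sqrt (Nat.sqrt Q)) ^ 8 ≤ Q :=
  (le_sqrt_sqrt_sqrt_iff _ Q).1 le_rfl

/- `Q < (r(Q) + 1)⁸` is also the tree's `Literature.NumberTheory.Sieve.GreenAC0.lt_succ_kk_pow`
(`MoebiusWalshCircuitsGreenProofs.lean`, a heavy import); it is re-derived inline where needed (3 lines) from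
`le_sqrt_sqrt_sqrt_iff`, not restated as a theorem. -/

/-- `q ≤ t(Q) ↔ q¹⁶ ≤ Q` for `t(Q) = Nat.sqrt (r(Q))`. -/
theorem le_sqrt_four_iff (q Q : ℕ) : q ≤ Nat.sqrt (Nat.sqrt (Nat.sqrt (Nat.sqrt Q))) ↔ q ^ 16 ≤ Q := by
  rw [Nat.le_sqrt', le_sqrt_sqrt_sqrt_iff, ← pow_mul]

/-- `t(Q)¹⁶ ≤ Q`. -/
theorem sqrt_four_pow_sixteen_le (Q : ℕ) : Nat.sqrt (Nat.sqrt (Nat.sqrt (Nat.sqrt Q))) ^ 16 ≤ Q :=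
  (le_sqrt_four_iff _ Q).1 le_rfl

/-- `Q < (t(Q) + 1)¹⁶`. -/
theorem lt_sqrt_four_succ_pow_sixteen (Q : ℕ) : Q < (Nat.sqrt (Nat.sqrt (Nat.sqrt (Nat.sqrt Q))) + 1) ^ 16 := by
  by_contra h
  have := (le_sqrt_four_iff _ Q).2 (not_lt.1 h)
  omega

/-! ## §2 Membership in the sifted set; primes `> Q^{1/8}` are sifted -/

/-- Unfolding `sifted`. -/
theorem mem_sifted_iff (Q m : ℕ) : m ∈ sifted Q ↔ (1 ≤ m ∧ m ≤ Q) ∧ m % 16 = 7 ∧ Squarefree m ∧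
    ∀ q : ℕ, q.Prime → q ∣ m → Nat.sqrt (Nat.sqrt (Nat.sqrt Q)) < q := by
  rw [sifted, Finset.mem_filter, Finset.mem_Icc]

/-- A prime `p ≤ Q` with `p ≡ 7 (16)` and `p > r(Q)` (i.e. `p⁸ > Q`) is a sifted modulus. -/
theorem prime_mem_sifted {Q p : ℕ} (hp : p.Prime) (hpQ : p ≤ Q) (h16 : p % 16 = 7)
    (hr : Nat.sqrt (Nat.sqrt (Nat.sqrt Q)) < p) : p ∈ sifted Q := by
  rw [mem_sifted_iff]
  refine ⟨⟨hp.one_lt.le, hpQ⟩, h16, hp.prime.squarefree, fun q hq hqp => ?_⟩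
  rwa [(Nat.prime_dvd_prime_iff_eq hq hp).1 hqp]

/-- A sifted modulus is coprime to every prime `q ≤ t(Q)` (indeed to every prime `q ≤ r(Q)`), hence to
`P(t(Q) + 1) = ∏_{q ≤ t(Q)} q`. -/
theorem coprime_primesProdBelow_of_mem_sifted {Q m : ℕ} (hm : m ∈ sifted Q) :
    m.Coprime (primesProdBelow (((Nat.sqrt (Nat.sqrt (Nat.sqrt (Nat.sqrt Q))) + 1 : ℕ) : ℝ))) := by
  rw [primesProdBelow, Nat.ceil_natCast]
  refine Nat.Coprime.prod_right fun q hq => ?_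
  rw [Nat.mem_primesBelow] at hq
  refine Nat.coprime_comm.1 ((Nat.Prime.coprime_iff_not_dvd hq.2).2 fun hqm => ?_)
  have h1 := ((mem_sifted_iff Q m).1 hm).2.2.2 q hq.2 hqm
  have h2 := Nat.sqrt_le_self (Nat.sqrt (Nat.sqrt (Nat.sqrt Q)))
  omega

/-! ## §3 The sieve count `#sifted(Q) ≪ Q / log Q` (z-rough integers, Brun–Titchmarsh shape, from the tree's
PROVED `Literature.NumberTheory.Sieve.card_roughAP_le` with `q = 1`, `z = t(Q) + 1 ≈ Q^{1/16}`) -/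

/-- **The sifted moduli are few**: there is an absolute `C > 0` with `#sifted(Q) ≤ C · Q / log Q` for all `Q ≥ 2`.
Proof: `sifted Q ⊆ {n ≤ Q : (n, P(z)) = 1}` with `z = t(Q) + 1` (every prime `< z` is `≤ r(Q)`), the tree's bound
`#{n ≤ Q : (n, P(z)) = 1} ≤ K (Q / log z + z¹⁰)` (`card_roughAP_le`, the beta-sieve Brun–Titchmarsh bound for sifted
progressions, modulus `1`), and the elementary estimates `log Q < 16 log z` (from `Q < z¹⁶`), `log Q ≤ 16 t(Q)`,
`z¹⁰ ≤ 2¹⁰ t¹⁰ ≤ 2¹⁰ t¹⁵ ≤ 2¹⁴ Q / log Q` (from `t¹⁶ ≤ Q`); `C = 16400 K`. -/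
theorem card_sifted_le : ∃ C : ℝ, 0 < C ∧ ∀ Q : ℕ, 2 ≤ Q → ((sifted Q).card : ℝ) ≤ C * Q / Real.log Q := by
  obtain ⟨K, hK, hB⟩ := card_roughAP_le
  refine ⟨16400 * K, by positivity, fun Q hQ => ?_⟩
  -- notation
  set t : ℕ := Nat.sqrt (Nat.sqrt (Nat.sqrt (Nat.sqrt Q))) with ht
  set z : ℝ := ((t + 1 : ℕ) : ℝ) with hz
  have ht1 : 1 ≤ t := (le_sqrt_four_iff 1 Q).2 (by simpa using (by omega : 1 ≤ Q))
  have htR : (1 : ℝ) ≤ t := by exact_mod_cast ht1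
  have hz2 : (2 : ℝ) ≤ z := by rw [hz]; push_cast; linarith
  have hz0 : (0 : ℝ) < z := by linarith
  have hQR : (2 : ℝ) ≤ Q := by exact_mod_cast hQ
  have hQ0 : (0 : ℝ) ≤ Q := by linarith
  have hlogQ : 0 < Real.log Q := Real.log_pos (by linarith)
  -- `log Q < 16 log z` and `log z ≤ t`
  have hQlt : (Q : ℝ) < z ^ 16 := by
    rw [hz]; exact_mod_cast lt_sqrt_four_succ_pow_sixteen Q
  have hlog16 : Real.log Q < 16 * Real.log z := by
    have := Real.log_lt_log (by linarith) hQlt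
    rwa [Real.log_pow] at this
  have hlogz_le : Real.log z ≤ t := by
    have := Real.log_le_sub_one_of_pos hz0
    rw [hz] at this ⊢; push_cast at this ⊢; linarith
  have hlogQt : Real.log Q ≤ 16 * t := by linarith
  have hlogz : 0 < Real.log z := Real.log_pos (by linarith)
  -- `t¹⁶ ≤ Q`
  have ht16 : (t : ℝ) ^ 16 ≤ Q := by exact_mod_cast sqrt_four_pow_sixteen_le Q
  -- the sieve bound
  have hsub : sifted Q ⊆ (Finset.Ioc 0 ⌊(Q : ℝ)⌋₊).filter
      (fun n : ℕ => n ≡ 0 [MOD 1] ∧ n.Coprime (primesProdBelow z)) := by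
    intro m hm
    rw [Nat.floor_natCast, Finset.mem_filter, Finset.mem_Ioc]
    have h := (mem_sifted_iff Q m).1 hm
    exact ⟨⟨h.1.1, h.1.2⟩, Nat.modEq_one, coprime_primesProdBelow_of_mem_sifted hm⟩
  have hsieve := hB z hz2 1 one_pos 0 (Nat.coprime_one_right 0) Q hQ0
  rw [Nat.totient_one, Nat.cast_one, one_mul] at hsieve
  have hcard : ((sifted Q).card : ℝ) ≤ K * (Q / Real.log z + z ^ 10) :=
    le_trans (by exact_mod_cast Finset.card_le_card hsub) hsieve
  -- `Q / log z ≤ 16 Q / log Q`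
  have hA : (Q : ℝ) / Real.log z ≤ 16 * Q / Real.log Q := by
    rw [div_le_div_iff₀ hlogz hlogQ]
    nlinarith
  -- `z¹⁰ ≤ 16384 Q / log Q`
  have hB' : z ^ 10 ≤ 16384 * Q / Real.log Q := by
    have h1 : z ≤ 2 * t := by rw [hz]; push_cast; linarith
    have h2 : z ^ 10 ≤ (2 * t) ^ 10 := pow_le_pow_left₀ hz0.le h1 10
    have h3 : ((t : ℝ)) ^ 10 ≤ (t : ℝ) ^ 15 := pow_le_pow_right₀ htR (by norm_num)
    have h4 : (t : ℝ) ^ 15 * Real.log Q ≤ 16 * Q := by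
      calc (t : ℝ) ^ 15 * Real.log Q ≤ (t : ℝ) ^ 15 * (16 * t) :=
            mul_le_mul_of_nonneg_left hlogQt (by positivity)
        _ = 16 * (t : ℝ) ^ 16 := by ring
        _ ≤ 16 * Q := by linarith
    rw [le_div_iff₀ hlogQ]
    calc z ^ 10 * Real.log Q ≤ (2 * t) ^ 10 * Real.log Q := mul_le_mul_of_nonneg_right h2 hlogQ.le
      _ = 1024 * ((t : ℝ) ^ 10 * Real.log Q) := by ring
      _ ≤ 1024 * ((t : ℝ) ^ 15 * Real.log Q) := by gcongr
      _ ≤ 1024 * (16 * Q) := by gcongr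
      _ = 16384 * Q := by ring
  calc ((sifted Q).card : ℝ) ≤ K * (Q / Real.log z + z ^ 10) := hcard
    _ ≤ K * (16 * Q / Real.log Q + 16384 * Q / Real.log Q) := by gcongr
    _ = 16400 * K * Q / Real.log Q := by ring

/-! ## §4 The Chebyshev step: the variance bounds the number of vanishing terms -/

/-- **Chebyshev / variance step** (the card's «expand the square»): if `|Σ (x − 1)| ≤ ε n` and `Σ x² ≤ (1 + ε) n` over a
finite set of size `n`, then `Σ (x − 1)² ≤ 3 ε n`, because `Σ (x − 1)² = Σ x² − 2 Σ (x − 1) − n`. -/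
theorem sum_sub_one_sq_le {ι : Type*} (s : Finset ι) (x : ι → ℝ) {ε : ℝ}
    (h1 : |∑ i ∈ s, (x i - 1)| ≤ ε * s.card) (h2 : ∑ i ∈ s, x i ^ 2 ≤ (1 + ε) * s.card) :
    ∑ i ∈ s, (x i - 1) ^ 2 ≤ 3 * ε * s.card := by
  have hid : ∑ i ∈ s, (x i - 1) ^ 2 = ∑ i ∈ s, x i ^ 2 - 2 * ∑ i ∈ s, (x i - 1) - s.card := by
    rw [Finset.card_eq_sum_ones s, Nat.cast_sum, Finset.mul_sum, ← Finset.sum_sub_distrib,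
      ← Finset.sum_sub_distrib]
    exact Finset.sum_congr rfl fun i _ => by push_cast; ring
  have h3 := (abs_le.1 h1).1
  rw [hid]
  linarith

/-- The terms `(x − 1)²` are `1` where `x = 0`, so `#{i ∈ E} ≤ Σ_{i ∈ s} (x i − 1)²` for any `E ⊆ s` on which `x` vanishes. -/
theorem card_le_sum_sub_one_sq {ι : Type*} {s E : Finset ι} (x : ι → ℝ) (hE : E ⊆ s) (hx : ∀ i ∈ E, x i = 0) :
    (E.card : ℝ) ≤ ∑ i ∈ s, (x i - 1) ^ 2 := by
  calc (E.card : ℝ) = ∑ i ∈ E, (x i - 1) ^ 2 := by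
        rw [Finset.card_eq_sum_ones E, Nat.cast_sum]
        exact Finset.sum_congr rfl fun i hi => by rw [hx i hi]; norm_num
    _ ≤ ∑ i ∈ s, (x i - 1) ^ 2 :=
        Finset.sum_le_sum_of_subset_of_nonneg hE fun i _ _ => sq_nonneg _

/-! ## §5 The exceptional primes: those `> r(Q)` are sifted moduli with vanishing window moment

The EXCEPTIONAL SET of the census at height `Q` — primes `p ≤ Q`, `p ≡ 7 (16)`, whose whole Heegner window
`D(p, (log₂ Q)³)` has `L(B_p^{(d)}, 1) = 0` — is written out below exactly as the finset counted in `CellFreeCensus`,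
`(Finset.Icc 1 Q).filter (fun p => p.Prime ∧ p % 16 = 7 ∧ ∀ d ∈ Dset p (window Q), Lval p d = 0)`. -/

/-- On an exceptional prime the window moment vanishes: `S(p, y) = 0`. -/
theorem S_eq_zero_of_mem_exceptional {Q p : ℕ}
    (hp : p ∈ (Finset.Icc 1 Q).filter (fun p => p.Prime ∧ p % 16 = 7 ∧ ∀ d ∈ Dset p (window Q), Lval p d = 0)) :
    S p (window Q) = 0 := by
  rw [Finset.mem_filter] at hp
  exact Finset.sum_eq_zero fun d hd => hp.2.2.2 d hd

/-- Hence its normalised moment `S/(A·#D)` is `0`. -/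
theorem normalised_eq_zero_of_mem_exceptional {Q p : ℕ} (A : ℝ)
    (hp : p ∈ (Finset.Icc 1 Q).filter (fun p => p.Prime ∧ p % 16 = 7 ∧ ∀ d ∈ Dset p (window Q), Lval p d = 0)) :
    S p (window Q) / (A * ((Dset p (window Q)).card : ℝ)) = 0 := by
  rw [S_eq_zero_of_mem_exceptional hp, zero_div]

/-- The exceptional primes above `r(Q)` are sifted moduli. -/
theorem exceptional_filter_subset_sifted (Q : ℕ) :
    ((Finset.Icc 1 Q).filter (fun p => p.Prime ∧ p % 16 = 7 ∧ ∀ d ∈ Dset p (window Q), Lval p d = 0)).filter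
      (fun p => Nat.sqrt (Nat.sqrt (Nat.sqrt Q)) < p) ⊆ sifted Q := by
  intro p hp
  rw [Finset.mem_filter, Finset.mem_filter, Finset.mem_Icc] at hp
  exact prime_mem_sifted hp.1.2.1 hp.1.1.2 hp.1.2.2.1 hp.2

/-- The exceptional primes up to `r(Q)` number at most `r(Q) ≤ Q^{1/8}`. -/
theorem card_exceptional_filter_le (Q : ℕ) :
    (((Finset.Icc 1 Q).filter (fun p => p.Prime ∧ p % 16 = 7 ∧ ∀ d ∈ Dset p (window Q), Lval p d = 0)).filter
      (fun p => ¬ Nat.sqrt (Nat.sqrt (Nat.sqrt Q)) < p)).card ≤ Nat.sqrt (Nat.sqrt (Nat.sqrt Q)) := by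
  set E := (Finset.Icc 1 Q).filter (fun p => p.Prime ∧ p % 16 = 7 ∧ ∀ d ∈ Dset p (window Q), Lval p d = 0) with hE
  calc (E.filter (fun p => ¬ Nat.sqrt (Nat.sqrt (Nat.sqrt Q)) < p)).card
      ≤ (Finset.Icc 1 (Nat.sqrt (Nat.sqrt (Nat.sqrt Q)))).card := by
        refine Finset.card_le_card fun p hp => ?_
        rw [Finset.mem_filter, hE, Finset.mem_filter, Finset.mem_Icc] at hp
        rw [Finset.mem_Icc]
        exact ⟨hp.1.1.1, not_lt.1 hp.2⟩
    _ = Nat.sqrt (Nat.sqrt (Nat.sqrt Q)) := by simp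

/-- **Quantitative census** (explicit form of the glue): if at height `Q` the normalised window moments over the
sifted moduli satisfy `|Σ (x − 1)| ≤ ε #sifted` and `Σ x² ≤ (1 + ε) #sifted`, then
`#exceptional(Q) ≤ 3 ε · #sifted(Q) + r(Q)`, `r(Q) = ⌊Q^{1/8}⌋` (no largeness needed). -/
theorem card_exceptional_le_of_moments {A ε : ℝ} {Q : ℕ}
    (h1 : |∑ m ∈ sifted Q, (S m (window Q) / (A * (Dset m (window Q)).card) - 1)| ≤ ε * (sifted Q).card)
    (h2 : ∑ m ∈ sifted Q, (S m (window Q) / (A * (Dset m (window Q)).card)) ^ 2 ≤ (1 + ε) * (sifted Q).card) :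
    ((((Finset.Icc 1 Q).filter
        (fun p => p.Prime ∧ p % 16 = 7 ∧ ∀ d ∈ Dset p (window Q), Lval p d = 0)).card : ℕ) : ℝ) ≤
      3 * ε * (sifted Q).card + Nat.sqrt (Nat.sqrt (Nat.sqrt Q)) := by
  set E := (Finset.Icc 1 Q).filter (fun p => p.Prime ∧ p % 16 = 7 ∧ ∀ d ∈ Dset p (window Q), Lval p d = 0) with hE
  set r := Nat.sqrt (Nat.sqrt (Nat.sqrt Q)) with hr
  have hsplit := Finset.card_filter_add_card_filter_not (s := E) (fun p => r < p)
  have hbig : ((E.filter (fun p => r < p)).card : ℝ) ≤ 3 * ε * (sifted Q).card :=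
    le_trans (card_le_sum_sub_one_sq (fun m => S m (window Q) / (A * ((Dset m (window Q)).card : ℝ)))
      (exceptional_filter_subset_sifted Q)
      (fun p hp => normalised_eq_zero_of_mem_exceptional A (Finset.mem_filter.1 hp).1))
      (sum_sub_one_sq_le (sifted Q) _ h1 h2)
  have hsmall : ((E.filter (fun p => ¬ r < p)).card : ℝ) ≤ r := by
    exact_mod_cast card_exceptional_filter_le Q
  have : (E.card : ℝ) = ((E.filter (fun p => r < p)).card : ℝ) + ((E.filter (fun p => ¬ r < p)).card : ℝ) := by
    exact_mod_cast hsplit.symm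
  rw [this]
  exact add_le_add hbig hsmall

/-! ## §6 ★ The glue: the moments imply the census -/

/-- `r(Q) = ⌊Q^{1/8}⌋` is eventually below `δ Q / log Q`: for `δ > 0` there is `Q₀` with `r(Q) ≤ δ Q / log Q` for all
`Q ≥ Q₀` (from `r⁸ ≤ Q < (r + 1)⁸`: `log Q ≤ 8 r`, so `δ Q / log Q ≥ δ r⁷ / 8 ≥ r` once `δ r⁶ ≥ 8`). -/
theorem sqrt_sqrt_sqrt_le_eventually {δ : ℝ} (hδ : 0 < δ) :
    ∃ Q₀ : ℕ, ∀ Q : ℕ, Q₀ ≤ Q → (Nat.sqrt (Nat.sqrt (Nat.sqrt Q)) : ℝ) ≤ δ * Q / Real.log Q := by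
  -- an integer `k ≥ 1` with `8 ≤ δ k`
  obtain ⟨k, hk⟩ := exists_nat_ge (8 / δ)
  refine ⟨max 2 ((k + 1) ^ 8), fun Q hQ => ?_⟩
  have hQ2 : 2 ≤ Q := le_trans (le_max_left _ _) hQ
  have hQk : (k + 1) ^ 8 ≤ Q := le_trans (le_max_right _ _) hQ
  set r := Nat.sqrt (Nat.sqrt (Nat.sqrt Q)) with hr
  have hkr : k + 1 ≤ r := (le_sqrt_sqrt_sqrt_iff _ Q).2 hQk
  have hr1 : (1 : ℝ) ≤ r := by exact_mod_cast (by omega : 1 ≤ r)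
  have hr0 : (0 : ℝ) < r := by linarith
  have hδr : 8 ≤ δ * r := by
    have hk' : 8 / δ ≤ r := le_trans hk (by exact_mod_cast (by omega : k ≤ r))
    rwa [div_le_iff₀ hδ, mul_comm] at hk'
  have hQR : (2 : ℝ) ≤ Q := by exact_mod_cast hQ2
  have hlogQ : 0 < Real.log Q := Real.log_pos (by linarith)
  -- `log Q ≤ 8 r` and `r⁸ ≤ Q`
  have hQlt' : Q < (r + 1) ^ 8 := by
    by_contra h
    have := (le_sqrt_sqrt_sqrt_iff _ Q).2 (not_lt.1 h)
    omega
  have hQlt : (Q : ℝ) < ((r : ℝ) + 1) ^ 8 := by exact_mod_cast hQlt'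
  have hlog8 : Real.log Q ≤ 8 * r := by
    have h1 := Real.log_lt_log (by linarith) hQlt
    rw [Real.log_pow] at h1
    have h2 := Real.log_le_sub_one_of_pos (show (0 : ℝ) < r + 1 by linarith)
    push_cast at h1
    linarith
  have hr8 : (r : ℝ) ^ 8 ≤ Q := by exact_mod_cast sqrt_sqrt_sqrt_pow_eight_le Q
  -- assemble: `r log Q ≤ 8 r² ≤ δ r⁸ ≤ δ Q`
  rw [le_div_iff₀ hlogQ]
  have h6 : (r : ℝ) ≤ (r : ℝ) ^ 6 := le_self_pow₀ hr1 (by norm_num)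
  have h7 : 8 * (r : ℝ) ^ 2 ≤ δ * (r : ℝ) ^ 8 := by
    have : 8 * (r : ℝ) ≤ δ * r * (r : ℝ) ^ 6 := by nlinarith
    nlinarith
  calc (r : ℝ) * Real.log Q ≤ (r : ℝ) * (8 * r) := mul_le_mul_of_nonneg_left hlog8 hr0.le
    _ = 8 * (r : ℝ) ^ 2 := by ring
    _ ≤ δ * (r : ℝ) ^ 8 := h7
    _ ≤ δ * Q := mul_le_mul_of_nonneg_left hr8 hδ.le

/-- ★ **The card's glue, PROVED unconditionally**: `CensusOfMoments`, i.e. the sifted first + mixed second moment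
asymptotics `SiftedMoments A` (for some `A > 0`) imply the cell-free census `CellFreeCensus`. Given `ε > 0`: apply
`SiftedMoments` with `ε₁ = ε / (6 C)` (`C` the sieve constant of `card_sifted_le`), so that for large `Q` the
exceptional primes `> Q^{1/8}` number `≤ 3 ε₁ #sifted ≤ (ε/2) Q / log Q` (Chebyshev), and those `≤ Q^{1/8}` number
`≤ Q^{1/8} ≤ (ε/2) Q / log Q`. This certifies ONLY the composition step of the card `sifted-variance-twist-census`;
its analytic input `SiftedMoments` is research and is NOT proved here; the crux stmt-21381 and BSD are untouched. -/
theorem censusOfMoments : CensusOfMoments := by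
  rintro ⟨A, -, hSM⟩ ε hε
  obtain ⟨C, hC, hcard⟩ := card_sifted_le
  obtain ⟨Q₁, hQ₁⟩ := hSM (ε / (6 * C)) (by positivity)
  obtain ⟨Q₂, hQ₂⟩ := sqrt_sqrt_sqrt_le_eventually (half_pos hε)
  refine ⟨max Q₁ (max Q₂ 2), fun Q hQ => ?_⟩
  have hQ1 : Q₁ ≤ Q := le_trans (le_max_left _ _) hQ
  have hQ2 : Q₂ ≤ Q := le_trans (le_trans (le_max_left _ _) (le_max_right _ _)) hQ
  have hQ3 : 2 ≤ Q := le_trans (le_trans (le_max_right _ _) (le_max_right _ _)) hQ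
  obtain ⟨h1, h2⟩ := hQ₁ Q hQ1
  have hE := card_exceptional_le_of_moments h1 h2
  have hS := hcard Q hQ3
  have hr := hQ₂ Q hQ2
  have hεC : 3 * (ε / (6 * C)) * ((sifted Q).card : ℝ) ≤ ε / 2 * Q / Real.log Q := by
    have : 3 * (ε / (6 * C)) * ((sifted Q).card : ℝ) ≤ 3 * (ε / (6 * C)) * (C * Q / Real.log Q) :=
      mul_le_mul_of_nonneg_left hS (by positivity)
    calc _ ≤ 3 * (ε / (6 * C)) * (C * Q / Real.log Q) := this
      _ = ε / 2 * Q / Real.log Q := by field_simp; ring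
  calc _ ≤ 3 * (ε / (6 * C)) * ((sifted Q).card : ℝ) + Nat.sqrt (Nat.sqrt (Nat.sqrt Q)) := hE
    _ ≤ ε / 2 * Q / Real.log Q + ε / 2 * Q / Real.log Q := add_le_add hεC hr
    _ = ε * Q / Real.log Q := by ring

/-- The same, with the two `Prop`s unfolded one level: `SiftedMoments A → CellFreeCensus` for every `A > 0`. -/
theorem cellFreeCensus_of_siftedMoments {A : ℝ} (hA : 0 < A) (h : SiftedMoments A) : CellFreeCensus :=
  censusOfMoments ⟨A, hA, h⟩

end Summit.BirchSwinnertonDyer.BirchSwinnertonDyer.Theorems.SiftedVarianceCensus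

end
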